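import Mathlib.RepresentationTheory.Homological.ContCohomology.Functoriality
import Mathlib.Algebra.Homology.ShortComplex.ModuleCat
import Literature.NumberTheory.GaloisRepresentations.ContinuousH1
import HarnessLib

/-!
# Vanishing criteria and long-exact-sequence pieces for continuous cohomology (cochain level)

Mathlib's continuous group cohomology `continuousCohomology n X` (`X : TopRep k G`) is the
homology of the complex `TopRep.homogeneousCochains X` of `G`-invariant continuous cochains
`C(G, C(G, ⋯ C(G, X)))` in the non-abelian category `TopModuleCat k`; as of this Mathlib there is
no long exact sequence and no acyclicity result. This file provides the element-level tools used
by the dimension-shifting arguments of Serre, *Cohomologie galoisienne* I §3.3 / Shatz,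
*Profinite groups, arithmetic, and geometry* III §1 (Tower Theorem):

* `subsingleton_homology_succ_iff`: for a cochain complex `K` of topological modules indexed by
  `ℕ`, `H^{n+1}(K)` has one element iff every `(n+1)`-cocycle is a coboundary (the underlying
  module of Mathlib's homology object is the usual subquotient).
* The three pieces of the long exact cohomology sequence that dimension shifting needs, for maps
  of complexes `φ : K ⟶ L`, `ψ : L ⟶ M` that are **degreewise** short exact (hypotheses
  `hinj`, `hmid`, `hsurj`, `hcomp`), in vanishing form:
  `subsingleton_homology_X₃` (`H^{n+1}(L) = 0`, `H^{n+2}(K) = 0` ⟹ `H^{n+1}(M) = 0`),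
  `subsingleton_homology_X₁` (`H^{n+1}(M) = 0`, `H^{n+2}(L) = 0` ⟹ `H^{n+2}(K) = 0`),
  `subsingleton_homology_one_X₁_iff` (`H^1(L) = 0` ⟹ (`H^1(K) = 0` ⟺ `Z^0(L) → Z^0(M)` onto)).
  These are the usual diagram chases (Shatz II §1 Prop. 3; Cartan–Eilenberg).
* `subsingleton_continuousCohomology_of_iso`: `Hⁿ(G, X) = 0 ⟺ Hⁿ(G, Y) = 0` for isomorphic
  topological representations `X ≅ Y` (functoriality `ContinuousCohomology.map_comp`, `map_id`).
* `cochains_d_zero_eq_zero_iff`: a homogeneous `0`-cochain `τ ∈ C(G, X)^G` is a cocycle iff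
  it is constant, and then its value is a `G`-invariant of `X` (Shatz II §1 (6), Serre I §2.2:
  `H⁰(G, A) = A^G`).
* `resolutionHom`, `cochainsHom`: Mathlib's functoriality `resolutionMap` / `cochainsMap` along
  the identity of `G` (abbreviations, with the element-level formulas used downstream).

## References

* S. S. Shatz, *Profinite groups, arithmetic, and geometry*, Ann. of Math. Studies 67 (1972),
  Ch. II §1 (Prop. 2, Prop. 3, (6)). [Shatz1972]
* J.-P. Serre, *Cohomologie galoisienne*, 5e éd., Springer LNM 5 (1994; English translation
  *Galois Cohomology*, 1997), I §2.2. [SerreGaloisCohomology1997]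
-/

noncomputable section

open CategoryTheory Limits

universe u v

namespace Literature.NumberTheory.GaloisRepresentations

/-! ### Cochain complexes of topological modules indexed by `ℕ` -/

section Complexes

variable {k : Type u} [Ring k] [TopologicalSpace k]

/-- `(ComplexShape.up ℕ).next n = n + 1`. [folklore] -/
theorem up_nat_next (n : ℕ) : (ComplexShape.up ℕ).next n = n + 1 := CochainComplex.next ℕ n

/-- `(ComplexShape.up ℕ).prev (n + 1) = n`. [folklore] -/
theorem up_nat_prev_succ (n : ℕ) : (ComplexShape.up ℕ).prev (n + 1) = n :=
  CochainComplex.prev_nat_succ n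

/-- A zero object of `TopModuleCat k` has exactly one element. [folklore] -/
theorem subsingleton_of_isZero_topModuleCat {M : TopModuleCat.{v} k} (h : IsZero M) :
    Subsingleton M := by
  refine ⟨fun x y => ?_⟩
  have h1 : (𝟙 M : M ⟶ M) = 0 := h.eq_of_src _ _
  have hx : x = 0 := by simpa using congrArg (fun f : M ⟶ M => f.hom x) h1
  have hy : y = 0 := by simpa using congrArg (fun f : M ⟶ M => f.hom y) h1
  rw [hx, hy]

variable (K : CochainComplex (TopModuleCat.{v} k) ℕ)

/-- **Cocycles modulo coboundaries.** For a cochain complex `K` of topological `k`-modules,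
`H^{n+1}(K)` (Mathlib's homology object in `TopModuleCat k`) has a single element iff every
`x ∈ K^{n+1}` with `d x = 0` is of the form `d y`. (`→`: the explicit class `[x]` of
`Literature…cxClass` vanishes iff `x` is a boundary; `←`: the forgetful functor to `ModuleCat k`
is faithful and exactness there is the element statement.) [folklore] -/
theorem subsingleton_homology_succ_iff (n : ℕ) :
    Subsingleton (K.homology (n + 1)) ↔
      ∀ x : K.X (n + 1), K.d (n + 1) (n + 2) x = 0 → ∃ y : K.X n, K.d n (n + 1) y = x := by
  constructor
  · intro h x hx
    exact (cxClass_eq_zero_iff K (n + 1) (n + 2) (up_nat_next (n + 1)) n (up_nat_prev_succ n) x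
      hx).1 (Subsingleton.elim _ _)
  · intro H
    apply subsingleton_of_isZero_topModuleCat
    rw [← HomologicalComplex.exactAt_iff_isZero_homology,
      HomologicalComplex.exactAt_iff' K n (n + 1) (n + 2) (by simp) (by simp),
      ← ShortComplex.exact_map_iff_of_faithful _ (forget₂ (TopModuleCat k) (ModuleCat k)),
      ShortComplex.moduleCat_exact_iff]
    intro x₂ hx₂
    obtain ⟨y, hy⟩ := H x₂ hx₂
    exact ⟨y, hy⟩

variable {K} {L M : CochainComplex (TopModuleCat.{v} k) ℕ} (φ : K ⟶ L) (ψ : L ⟶ M)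

/-- `d (φ x) = φ (d x)` for a morphism of complexes, on elements. [folklore] -/
theorem hom_f_d_apply (i j : ℕ) (x : K.X i) : L.d i j (φ.f i x) = φ.f j (K.d i j x) := by
  rw [← CategoryTheory.comp_apply, φ.comm i j, CategoryTheory.comp_apply]

/-- `d (d x) = 0` on elements. [folklore] -/
theorem d_d_apply (K : CochainComplex (TopModuleCat.{v} k) ℕ) (i j l : ℕ) (x : K.X i) :
    K.d j l (K.d i j x) = 0 := by
  rw [← CategoryTheory.comp_apply, K.d_comp_d]
  rfl

/-- **Long exact sequence, exactness at `H^{n+1}(M)` in vanishing form.** If `K → L → M` is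
degreewise short exact and `H^{n+1}(L) = 0 = H^{n+2}(K)`, then `H^{n+1}(M) = 0`
(diagram chase for `Hⁿ⁺¹(L) → Hⁿ⁺¹(M) → Hⁿ⁺²(K)`). [cite: Shatz1972, Ch. II §1 Prop. 3] -/
theorem subsingleton_homology_X₃ (hcomp : ∀ i (x : K.X i), ψ.f i (φ.f i x) = 0)
    (hinj : ∀ i, Function.Injective (φ.f i))
    (hmid : ∀ i (y : L.X i), ψ.f i y = 0 → ∃ x, φ.f i x = y)
    (hsurj : ∀ i, Function.Surjective (ψ.f i)) (n : ℕ)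
    (hL : Subsingleton (L.homology (n + 1))) (hK : Subsingleton (K.homology (n + 2))) :
    Subsingleton (M.homology (n + 1)) := by
  rw [subsingleton_homology_succ_iff] at hL hK ⊢
  intro c hc
  obtain ⟨b, rfl⟩ := hsurj (n + 1) c
  -- `d b` maps to `0` in `M`, hence comes from `a ∈ K^{n+2}` with `d a = 0`
  have hdb : ψ.f (n + 2) (L.d (n + 1) (n + 2) b) = 0 := by rw [← hom_f_d_apply, hc]
  obtain ⟨a, ha⟩ := hmid (n + 2) _ hdb
  have hda : K.d (n + 2) (n + 3) a = 0 := by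
    apply hinj (n + 3)
    rw [← hom_f_d_apply, ha, d_d_apply, map_zero]
  obtain ⟨a', rfl⟩ := hK a hda
  -- `b - φ a'` is a cocycle, hence a coboundary
  have hb' : L.d (n + 1) (n + 2) (b - φ.f (n + 1) a') = 0 := by
    rw [map_sub, hom_f_d_apply, ha, sub_self]
  obtain ⟨b'', hb''⟩ := hL _ hb'
  refine ⟨ψ.f n b'', ?_⟩
  rw [hom_f_d_apply, hb'', map_sub, hcomp, sub_zero]

/-- **Long exact sequence, exactness at `H^{n+2}(K)` in vanishing form.** If `K → L → M` is
degreewise short exact and `H^{n+1}(M) = 0 = H^{n+2}(L)`, then `H^{n+2}(K) = 0`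
(diagram chase for `Hⁿ⁺¹(M) → Hⁿ⁺²(K) → Hⁿ⁺²(L)`; this is dimension shifting
`Hⁿ⁺¹(M) ↠ Hⁿ⁺²(K)` when `L` is acyclic). [cite: Shatz1972, Ch. II §1 Prop. 3 and §2 Prop. 6] -/
theorem subsingleton_homology_X₁ (hcomp : ∀ i (x : K.X i), ψ.f i (φ.f i x) = 0)
    (hinj : ∀ i, Function.Injective (φ.f i))
    (hmid : ∀ i (y : L.X i), ψ.f i y = 0 → ∃ x, φ.f i x = y)
    (hsurj : ∀ i, Function.Surjective (ψ.f i)) (n : ℕ)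
    (hM : Subsingleton (M.homology (n + 1))) (hL : Subsingleton (L.homology (n + 2))) :
    Subsingleton (K.homology (n + 2)) := by
  rw [subsingleton_homology_succ_iff] at hM hL ⊢
  intro a ha
  -- `φ a` is a cocycle of the acyclic `L`: `φ a = d b`
  have hφa : L.d (n + 2) (n + 3) (φ.f (n + 2) a) = 0 := by rw [hom_f_d_apply, ha, map_zero]
  obtain ⟨b, hb⟩ := hL _ hφa
  -- `ψ b` is a cocycle of `M`: `ψ b = d c`, and `c = ψ b₀`
  have hψb : M.d (n + 1) (n + 2) (ψ.f (n + 1) b) = 0 := by rw [hom_f_d_apply, hb, hcomp]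
  obtain ⟨c, hc⟩ := hM _ hψb
  obtain ⟨b₀, rfl⟩ := hsurj n c
  -- `b - d b₀` maps to `0` in `M`, hence `b - d b₀ = φ a₁`, and then `d a₁ = a`
  have h1 : ψ.f (n + 1) (b - L.d n (n + 1) b₀) = 0 := by
    rw [map_sub, ← hom_f_d_apply, hc, sub_self]
  obtain ⟨a₁, ha₁⟩ := hmid (n + 1) _ h1
  refine ⟨a₁, hinj (n + 2) ?_⟩
  rw [← hom_f_d_apply, ha₁, map_sub, d_d_apply, sub_zero, hb]

/-- **Low degree.** If `K → L → M` is degreewise short exact and `H¹(L) = 0`, then `H¹(K) = 0`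
iff every `0`-cocycle of `M` lifts to a `0`-cocycle of `L` (exactness of
`H⁰(L) → H⁰(M) → H¹(K) → H¹(L) = 0`). [cite: Shatz1972, Ch. II §1 Prop. 3] -/
theorem subsingleton_homology_one_X₁_iff (hcomp : ∀ i (x : K.X i), ψ.f i (φ.f i x) = 0)
    (hinj : ∀ i, Function.Injective (φ.f i))
    (hmid : ∀ i (y : L.X i), ψ.f i y = 0 → ∃ x, φ.f i x = y)
    (hsurj : ∀ i, Function.Surjective (ψ.f i)) (hL : Subsingleton (L.homology 1)) :
    Subsingleton (K.homology 1) ↔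
      ∀ c : M.X 0, M.d 0 1 c = 0 → ∃ b : L.X 0, L.d 0 1 b = 0 ∧ ψ.f 0 b = c := by
  rw [subsingleton_homology_succ_iff] at hL ⊢
  constructor
  · intro hK c hc
    obtain ⟨b, rfl⟩ := hsurj 0 c
    have hdb : ψ.f 1 (L.d 0 1 b) = 0 := by rw [← hom_f_d_apply, hc]
    obtain ⟨a, ha⟩ := hmid 1 _ hdb
    have hda : K.d 1 2 a = 0 := by
      apply hinj 2
      rw [← hom_f_d_apply, ha, d_d_apply, map_zero]
    obtain ⟨a', rfl⟩ := hK a hda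
    refine ⟨b - φ.f 0 a', ?_, ?_⟩
    · rw [map_sub, hom_f_d_apply, ha, sub_self]
    · rw [map_sub, hcomp, sub_zero]
  · intro H a ha
    have hφa : L.d 1 2 (φ.f 1 a) = 0 := by rw [hom_f_d_apply, ha, map_zero]
    obtain ⟨b, hb⟩ := hL _ hφa
    have hψb : M.d 0 1 (ψ.f 0 b) = 0 := by rw [hom_f_d_apply, hb, hcomp]
    obtain ⟨b₀, hb₀, hψ⟩ := H _ hψb
    have h1 : ψ.f 0 (b - b₀) = 0 := by rw [map_sub, hψ, sub_self]
    obtain ⟨a₁, ha₁⟩ := hmid 0 _ h1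
    refine ⟨a₁, hinj 1 ?_⟩
    rw [← hom_f_d_apply, ha₁, map_sub, hb₀, sub_zero, hb]

end Complexes

/-! ### The standard resolution: explicit formulas and functoriality in the module -/

section Resolution

open TopRep ContRepresentation ContinuousCohomology

variable {k : Type u} [Ring k] [TopologicalSpace k]
variable {G : Type v} [Group G] [TopologicalSpace G] [IsTopologicalGroup G]

set_option allowUnsafeReducibility true in
attribute [local reducible] CategoryTheory.Functor.mapHomologicalComplex

/-- The differential `d₀ : X → C(G, X)` of Mathlib's standard resolution is the constant map.
[folklore] -/
theorem d_zero_hom_apply (X : TopRep k G) (x : X) (g : G) : (d X 0).hom x g = x := rfl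

/-- The differential `d_{n+1} : C(G, Rₙ) → C(G, C(G, Rₙ))` of Mathlib's standard resolution:
`(d F)(g) = F - d_n (F g)`. [folklore] -/
theorem d_succ_hom_apply (X : TopRep k G) (n : ℕ) (F : C(G, resolutionX X n)) (g : G) :
    (d X (n + 1)).hom F g = F - (d X n).hom (F g) := rfl

/-- The `G`-action on the terms `C(G, Rₙ)` of the standard resolution:
`(g • F)(x) = g • F (g⁻¹ x)` (Mathlib `coind₁_apply_apply`). [folklore] -/
theorem resolutionX_succ_ρ_apply (X : TopRep k G) (n : ℕ) (g : G) (F : C(G, resolutionX X n))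
    (x : G) : (resolutionX X (n + 1)).ρ g F x = (resolutionX X n).ρ g (F (g⁻¹ * x)) := rfl

/-- The differential of the complex of homogeneous cochains on underlying functions
(Mathlib `homogeneousCochains.d_apply`, restated with the coercion to the resolution).
[folklore] -/
theorem cochains_d_coe (X : TopRep k G) (i : ℕ) (σ : (homogeneousCochains X).X i) :
    ((((homogeneousCochains X).d i (i + 1)).hom σ : (homogeneousCochains X).X (i + 1)) :
      resolutionX X (i + 2)) = (d X (i + 1)).hom σ.1 :=
  homogeneousCochains.d_apply X i σ

variable {A B C : TopRep k G}

/-- A morphism `f : A ⟶ B` of topological representations, seen as a morphism from the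
restriction of `A` along the identity of `G` (the source of Mathlib's
`ContinuousCohomology.resolutionMap` / `cochainsMap` / `map`). [folklore] -/
def resIdHom (f : A ⟶ B) : TopRep.res ((ContinuousMonoidHom.id G : G →ₜ* G) : G →* G) A ⟶ B :=
  TopRep.ofHom ⟨f.hom.toContinuousLinearMap, fun g => f.hom.isIntertwining' g⟩

omit [IsTopologicalGroup G] in
/-- `resIdHom f` is `f` on elements. [folklore] -/
@[simp] theorem resIdHom_hom_apply (f : A ⟶ B) (x : A) : (resIdHom f).hom x = f.hom x := rfl

/-- The morphism of standard resolutions induced by a morphism `f : A ⟶ B` of topological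
representations, in degree `n`: Mathlib's `ContinuousCohomology.resolutionMap` along the identity
of `G` (`f` in degree `0`, `F ↦ (resolutionHom f n) ∘ F` in degree `n + 1`). [folklore] -/
abbrev resolutionHom (f : A ⟶ B) (n : ℕ) :
    TopRep.res ((ContinuousMonoidHom.id G : G →ₜ* G) : G →* G) (resolutionX A n) ⟶
      resolutionX B n :=
  resolutionMap (ContinuousMonoidHom.id G) (resIdHom f) n

/-- In degree `0`, `resolutionHom f` is `f` on elements. [folklore] -/
@[simp] theorem resolutionHom_zero_hom_apply (f : A ⟶ B) (a : A) :
    (resolutionHom f 0).hom a = f.hom a := rfl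

/-- On functions, `resolutionHom f (n+1)` is post-composition with `resolutionHom f n`
(Mathlib `coind₁ResMap_apply`). [folklore] -/
theorem resolutionHom_succ_hom_apply (f : A ⟶ B) (n : ℕ) (F : C(G, resolutionX A n)) (x : G) :
    (resolutionHom f (n + 1)).hom F x = (resolutionHom f n).hom (F x) := rfl

/-- If `f ≫ g = 0` then `resolutionHom g n ∘ resolutionHom f n = 0` on elements. [folklore] -/
theorem resolutionHom_comp_apply_eq_zero (f : A ⟶ B) (g : B ⟶ C) (hfg : f ≫ g = 0) :
    ∀ (n : ℕ) (x : resolutionX A n), (resolutionHom g n).hom ((resolutionHom f n).hom x) = 0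
  | 0, x => congr(($hfg).hom x)
  | n + 1, x => by
    ext y : 1
    exact resolutionHom_comp_apply_eq_zero f g hfg n _

/-- The morphism of complexes of homogeneous cochains induced by a morphism `f : A ⟶ B` of
topological representations: Mathlib's `ContinuousCohomology.cochainsMap` along the identity
of `G`, so that `ContinuousCohomology.map (ContinuousMonoidHom.id G) (resIdHom f)` is the induced
map on cohomology. [folklore] -/
abbrev cochainsHom (f : A ⟶ B) : homogeneousCochains A ⟶ homogeneousCochains B :=
  cochainsMap (ContinuousMonoidHom.id G) (resIdHom f)

/-- `cochainsHom f` on underlying functions. [folklore] -/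
@[simp] theorem cochainsHom_f_coe (f : A ⟶ B) (i : ℕ) (σ : (homogeneousCochains A).X i) :
    (((cochainsHom f).f i σ : (homogeneousCochains B).X i) : resolutionX B (i + 1)) =
      (resolutionHom f (i + 1)).hom σ.1 := rfl

/-- If `f ≫ g = 0` then `cochainsHom g ∘ cochainsHom f = 0` on elements. [folklore] -/
theorem cochainsHom_comp_apply_eq_zero (f : A ⟶ B) (g : B ⟶ C) (hfg : f ≫ g = 0) (i : ℕ)
    (σ : (homogeneousCochains A).X i) : (cochainsHom g).f i ((cochainsHom f).f i σ) = 0 :=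
  Subtype.ext (resolutionHom_comp_apply_eq_zero f g hfg (i + 1) σ.1)

/-! ### Zero-cocycles -/

/-- A homogeneous `0`-cochain `τ ∈ C(G, X)^G` is a cocycle iff it is a constant function, whose
value is then `G`-invariant (Shatz II §1 (6), Serre I §2.2: `H⁰(G, A) = A^G`).
[cite: Shatz1972, Ch. II §1 (6)] [cite: SerreGaloisCohomology1997, I §2.2] -/
theorem cochains_d_zero_eq_zero_iff (X : TopRep k G) (τ : (homogeneousCochains X).X 0) :
    ((homogeneousCochains X).d 0 1).hom τ = 0 ↔
      ∃ v ∈ X.ρ.invariants, (τ.1 : C(G, X)) = ContinuousMap.const G v := by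
  constructor
  · intro h
    have h1 : ∀ x y : G, (τ.1 : C(G, X)) y - (τ.1 : C(G, X)) x = 0 := fun x y => by
      have := congr((($h : (homogeneousCochains X).X 1) : resolutionX X 2) x y)
      rw [cochains_d_coe] at this
      exact this
    refine ⟨(τ.1 : C(G, X)) 1, (mem_invariants _).2 fun g => ?_, ContinuousMap.ext fun x => ?_⟩
    · have h2 : (resolutionX X 1).ρ g τ.1 g = (τ.1 : C(G, X)) g := by
        rw [(mem_invariants _).1 τ.2 g]
      rw [resolutionX_succ_ρ_apply, inv_mul_cancel] at h2
      change X.ρ g ((τ.1 : C(G, X)) 1) = (τ.1 : C(G, X)) g at h2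
      rw [h2]
      exact sub_eq_zero.1 (h1 1 g)
    · exact sub_eq_zero.1 (h1 1 x)
  · rintro ⟨v, -, hv⟩
    apply Subtype.ext
    rw [cochains_d_coe, hv]
    ext x y
    rw [d_succ_hom_apply, ContinuousMap.sub_apply, d_zero_hom_apply, ContinuousMap.const_apply,
      ContinuousMap.const_apply, sub_self]
    rfl

end Resolution

/-! ### Invariance of vanishing under isomorphisms of topological representations -/

section Iso

open TopRep ContRepresentation ContinuousCohomology

variable {k : Type u} [Ring k] [TopologicalSpace k]
variable {G : Type v} [Group G] [TopologicalSpace G] [IsTopologicalGroup G]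

/-- The map on continuous cohomology induced by the identity of `G` and a morphism that is
pointwise the identity is the identity (Mathlib `ContinuousCohomology.map_id`). [folklore] -/
theorem map_id_eq_id {X : TopRep k G} (F : TopRep.res ((ContinuousMonoidHom.id G : G →ₜ* G) :
    G →* G) X ⟶ X) (hF : ∀ x : X, F.hom x = x) (q : ℕ) :
    ContinuousCohomology.map (ContinuousMonoidHom.id G) F q = 𝟙 _ := by
  have : F = 𝟙 X :=
    TopRep.hom_ext (ContIntertwiningMap.ext (ContinuousLinearMap.ext fun x => hF x))
  rw [this]
  exact ContinuousCohomology.map_id X q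

/-- **Vanishing of continuous cohomology is invariant under isomorphism of the coefficients**:
if `X ≅ Y` in `TopRep k G` and `Hⁿ(G, X)` has one element, so does `Hⁿ(G, Y)` (the maps induced
by `e.hom`, `e.inv` compose to the identity by `ContinuousCohomology.map_comp`, `map_id`).
[folklore] -/
theorem subsingleton_continuousCohomology_of_iso {X Y : TopRep k G} (e : X ≅ Y) (q : ℕ)
    [h : Subsingleton (continuousCohomology q X)] : Subsingleton (continuousCohomology q Y) := by
  let f := resIdHom e.inv
  let g := resIdHom e.hom
  have hcomp : ContinuousCohomology.map (ContinuousMonoidHom.id G) f q ≫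
      ContinuousCohomology.map (ContinuousMonoidHom.id G) g q = 𝟙 _ := by
    rw [← ContinuousCohomology.map_comp]
    refine map_id_eq_id _ (fun x => ?_) q
    change e.hom.hom (e.inv.hom x) = x
    rw [← TopRep.comp_apply, e.inv_hom_id, TopRep.id_apply]
  have key : ∀ x, (ContinuousCohomology.map (ContinuousMonoidHom.id G) g q).hom
      ((ContinuousCohomology.map (ContinuousMonoidHom.id G) f q).hom x) = x := fun x => by
    have hx := congr_arg (fun φ => φ.hom x) hcomp
    simpa using hx
  exact ⟨fun a b => by
    rw [← key a, ← key b, Subsingleton.elim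
      ((ContinuousCohomology.map (ContinuousMonoidHom.id G) f q).hom a)
      ((ContinuousCohomology.map (ContinuousMonoidHom.id G) f q).hom b)]⟩

/-- `Hⁿ(G, X) = 0 ⟺ Hⁿ(G, Y) = 0` for isomorphic topological representations. [folklore] -/
theorem subsingleton_continuousCohomology_iff_of_iso {X Y : TopRep k G} (e : X ≅ Y) (q : ℕ) :
    Subsingleton (continuousCohomology q X) ↔ Subsingleton (continuousCohomology q Y) :=
  ⟨fun _ => subsingleton_continuousCohomology_of_iso e q,
    fun _ => subsingleton_continuousCohomology_of_iso e.symm q⟩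

/-- An isomorphism of topological representations from a `G`-equivariant homeomorphic linear
equivalence (constructor). [folklore] -/
def topRepIsoOfEquiv {X Y : TopRep k G} (e : X ≃L[k] Y)
    (he : ∀ (g : G) (x : X), e (X.ρ g x) = Y.ρ g (e x)) : X ≅ Y where
  hom := TopRep.ofHom ⟨e.toContinuousLinearMap, fun g => by ext x; exact he g x⟩
  inv := TopRep.ofHom ⟨e.symm.toContinuousLinearMap, fun g => by
    ext y
    change e.symm (Y.ρ g y) = X.ρ g (e.symm y)
    apply e.injective
    rw [he, e.apply_symm_apply, e.apply_symm_apply]⟩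
  hom_inv_id := TopRep.hom_ext (ContIntertwiningMap.ext (ContinuousLinearMap.ext
    fun x => e.symm_apply_apply x))
  inv_hom_id := TopRep.hom_ext (ContIntertwiningMap.ext (ContinuousLinearMap.ext
    fun y => e.apply_symm_apply y))

end Iso

end Literature.NumberTheory.GaloisRepresentations

end
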